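import Summits.BirchSwinnertonDyer.BirchSwinnertonDyer.Theorems.ByReductionTypeAtTwoAdditivePotGoodPrintShuZhai20a1
import Summits.BirchSwinnertonDyer.BirchSwinnertonDyer.Theorems.ByReductionTypeAtTwoAdditivePotGoodPrintShuZhai52a1
import Summits.BirchSwinnertonDyer.BirchSwinnertonDyer.Theorems.ByReductionTypeAtTwoAdditivePotGoodPrintShuZhai84a1
import Literature.NumberTheory.EllipticCurves.ShuZhai2021.Table52AdditiveRows
import HarnessLib

/-!
# K4 crux `AdditiveRankZeroAtTwo` (19098), children C3″ (22617) / C2″ (22616): GEN 6's SHU–ZHAI roads at `20a1`, `52a1`, `84a1` re-keyed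
# BY NAME on the printed §5.2 Table rows (`ShuZhai2021.table52_row20a1/_row52a1/_row84a1`) — the displayed binders «optimal datum» (`Dt`,
# `hopt`) and «`f([0]) ∉ 2E(ℚ)`» (`hcusp`) DISCHARGED by print

Cell `bsd-2adic`, seat `bsd-2adic-k4-w2` GEN 7 (prover, explicit unit, no kit); `--supports stmt-BirchSwinnertonDyer-22616 --as helper` (cc C3″ 22617).
HONEST FRAMING (D-0036/D-0054): thin wrappers of GEN 6's `printFamily{20a1,52a1,84a1}_of_shuZhai` / `_rankOne_of_shuZhai` (p691407, p692691,
p699605) unpacking the table facts (p705532, statement-only lane, typed from the held arXiv text chunk p0014). After this file the only displayed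
inputs of the Shu–Zhai roads are Shu–Zhai's OWN conditions on the member (`Q` admissible, `hQM`: every `ℓ ∣ 2N` splits in `ℚ(√M)`), which the
witness files certify in the kernel at `M = 161 / 217 / 697`. Inputs BY NAME: Shu–Zhai Thm. 1.2 (`h12`), Thm. 1.4 (`h14`), the Table row
(`htab`), Creutz–Miller (`hCM`), Agashe–Ribet–Stein Thm. 2.6 (`h26`), modularity (`hmod`). Closes nothing at the `∀`-level; nothing booked;
BSD is not proved by any of this.

References: [ShuZhai2021] Thm. 1.2, Thm. 1.4, §5.2 Table (rows 20a1, 52a1, 84a1); [CreutzMiller2012] Thm. 1.1; [AgasheRibetStein2006] Thm. 2.6;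
[Miller2011LMS] Def. 1.1.
-/

set_option autoImplicit false
set_option linter.dupNamespace false

noncomputable section

open scoped Classical

open Module NumberField WeierstrassCurve Literature.NumberTheory.EllipticCurves
  Literature.NumberTheory.EllipticCurves.ModularForms
  Literature.NumberTheory.EllipticCurves.Rank1Residual
  Literature.NumberTheory.EllipticCurves.Rank1Residual.Typed
  Literature.NumberTheory.EllipticCurves.ShuZhai2021
  Literature.NumberTheory.EllipticCurves.AgasheRibetStein2006
  Summit.BirchSwinnertonDyer
  Summit.BirchSwinnertonDyer.Rank1Residual
  Summit.BirchSwinnertonDyer.Rank1Residual.X5.O1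
  Summit.BirchSwinnertonDyer.Rank1Residual.P2
  Summit.BirchSwinnertonDyer.BirchSwinnertonDyer.Rank1Residual.IntModel
  Summit.BirchSwinnertonDyer.BirchSwinnertonDyer.Theorems

namespace Summit.BirchSwinnertonDyer.BirchSwinnertonDyer.Theorems.AddPotGoodPrint

/-! ## The road at `20a1` by name from the Table row -/

/-- **THE SHU–ZHAI ROAD AT `20a1`, BY NAME from the §5.2 Table row** (`ShuZhai2021.table52_row20a1`: the optimal datum of `[0,1,0,4,4]` and
`f([0]) ∉ 2E(ℚ)`): for every finite set `Q` of admissible primes (`≠ 31`) with «every `ℓ ∣ 2N` splits in `ℚ(√M)`», `M = ∏ q*`, and every global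
minimal `W ≅ 20a1^{(M)}`: `r_an(W) = 0 ∧ Addv W 2 ∧ 0 ≤ ord₂ j(W) ∧ ¬CM ∧ Red W 2 ∧ BSD(W, 2) ∧ MissingLowerBoundAt W 2 ∧ MissingUpperBoundAt W 2`.
No displayed base datum. BSD is not proved by any of this.
[cite: ShuZhai2021, Thm. 1.2, Thm. 1.4 and §5.2 Table (row 20a1)] [cite: CreutzMiller2012, Thm. 1.1] [cite: AgasheRibetStein2006, Thm. 2.6] [cite: Miller2011LMS, Def. 1.1] -/
theorem printFamily20a1_of_shuZhai_of_table52 (h12 : thm12_ranks_of_twists) (h14 : thm14_twoPartBSD_of_twists)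
    (htab : table52_row20a1) (h26 : cremona_abs_maninConstant_eq_one_of_level_le) (hCM : bsdTriple_of_analyticRank_le_one_of_conductor_lt)
    (hmod : hasEntireLFunction_rat)
    (Q : Finset ℕ) (hQ : haveI := isElliptic_20a1;
      ∀ q ∈ Q, IsAdmissible (⟨0, 1, 0, 4, 4⟩ : WeierstrassCurve ℚ) (⟨0, 4, 0, -16, 0⟩ : WeierstrassCurve ℚ) q ∧ q ≠ 31)
    (hQM : haveI := isElliptic_20a1;
      AllPrimesSplitInSqrt (2 * (⟨0, 1, 0, 4, 4⟩ : WeierstrassCurve ℚ).conductorNorm ℤ) (∏ q ∈ Q, qStar q))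
    (W : WeierstrassCurve ℚ) [W.IsElliptic] [W.IsGloballyMinimal]
    (hW : ∃ C : VariableChange ℚ, C • (⟨0, 1, 0, 4, 4⟩ : WeierstrassCurve ℚ).quadraticTwist ((∏ q ∈ Q, qStar q : ℤ) : ℚ) = W) :
    haveI : Fact (Nat.Prime 2) := ⟨Nat.prime_two⟩
    W.analyticRank = 0 ∧ Addv W 2 ∧ 0 ≤ padicValRat 2 W.j ∧ ¬ W.HasCM ∧ Red W 2 ∧
      BSDp W 2 ∧ MissingLowerBoundAt W 2 ∧ MissingUpperBoundAt W 2 := by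
  obtain ⟨hN, Dt, hopt, hcusp⟩ := htab
  haveI := hN
  exact printFamily20a1_of_shuZhai h12 h14 h26 hCM hmod Dt hopt hcusp Q hQ hQM W hW

/-- **THE RANK-ONE COMPANIONS `20a1^{(−31M)}`, BY NAME from the Table row**: at every global minimal `W₁ ≅ 20a1^{(−31·M)}`: `r_an(W₁) = 1 ∧
Addv ∧ 0 ≤ ord₂ j ∧ ¬CM ∧ Red ∧ BSD(W₁, 2)`. BSD is not proved by any of this.
[cite: ShuZhai2021, Thm. 1.2, Thm. 1.4 and §5.2 Table (row 20a1)] [cite: CreutzMiller2012, Thm. 1.1] [cite: Miller2011LMS, Def. 1.1] -/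
theorem printFamily20a1_rankOne_of_shuZhai_of_table52 (h12 : thm12_ranks_of_twists) (h14 : thm14_twoPartBSD_of_twists)
    (htab : table52_row20a1) (h26 : cremona_abs_maninConstant_eq_one_of_level_le) (hCM : bsdTriple_of_analyticRank_le_one_of_conductor_lt)
    (hmod : hasEntireLFunction_rat)
    (Q : Finset ℕ) (hQ : haveI := isElliptic_20a1;
      ∀ q ∈ Q, IsAdmissible (⟨0, 1, 0, 4, 4⟩ : WeierstrassCurve ℚ) (⟨0, 4, 0, -16, 0⟩ : WeierstrassCurve ℚ) q ∧ q ≠ 31)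
    (hQM : haveI := isElliptic_20a1;
      AllPrimesSplitInSqrt (2 * (⟨0, 1, 0, 4, 4⟩ : WeierstrassCurve ℚ).conductorNorm ℤ) (∏ q ∈ Q, qStar q))
    (W₁ : WeierstrassCurve ℚ) [W₁.IsElliptic] [W₁.IsGloballyMinimal]
    (hW₁ : ∃ C : VariableChange ℚ,
      C • (⟨0, 1, 0, 4, 4⟩ : WeierstrassCurve ℚ).quadraticTwist ((-(31 : ℕ) * ∏ q ∈ Q, qStar q : ℤ) : ℚ) = W₁) :
    haveI : Fact (Nat.Prime 2) := ⟨Nat.prime_two⟩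
    W₁.analyticRank = 1 ∧ Addv W₁ 2 ∧ 0 ≤ padicValRat 2 W₁.j ∧ ¬ W₁.HasCM ∧ Red W₁ 2 ∧ BSDp W₁ 2 := by
  obtain ⟨hN, Dt, hopt, hcusp⟩ := htab
  haveI := hN
  exact printFamily20a1_rankOne_of_shuZhai h12 h14 h26 hCM hmod Dt hopt hcusp Q hQ hQM W₁ hW₁

/-! ## The road at `52a1` by name from the Table row -/

/-- **THE SHU–ZHAI ROAD AT `52a1`, BY NAME from the §5.2 Table row** (`ShuZhai2021.table52_row52a1`: the optimal datum of `[0,0,0,1,−10]` and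
`f([0]) ∉ 2E(ℚ)`): for every finite set `Q` of admissible primes (`≠ 23`) with «every `ℓ ∣ 2N` splits in `ℚ(√M)`», `M = ∏ q*`, and every global
minimal `W ≅ 52a1^{(M)}`: `r_an(W) = 0 ∧ Addv W 2 ∧ 0 ≤ ord₂ j(W) ∧ ¬CM ∧ Red W 2 ∧ BSD(W, 2) ∧ MissingLowerBoundAt W 2 ∧ MissingUpperBoundAt W 2`.
No displayed base datum. BSD is not proved by any of this.
[cite: ShuZhai2021, Thm. 1.2, Thm. 1.4 and §5.2 Table (row 52a1)] [cite: CreutzMiller2012, Thm. 1.1] [cite: AgasheRibetStein2006, Thm. 2.6] [cite: Miller2011LMS, Def. 1.1] -/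
theorem printFamily52a1_of_shuZhai_of_table52 (h12 : thm12_ranks_of_twists) (h14 : thm14_twoPartBSD_of_twists)
    (htab : table52_row52a1) (h26 : cremona_abs_maninConstant_eq_one_of_level_le) (hCM : bsdTriple_of_analyticRank_le_one_of_conductor_lt)
    (hmod : hasEntireLFunction_rat)
    (Q : Finset ℕ) (hQ : haveI := isElliptic_52a1;
      ∀ q ∈ Q, IsAdmissible (⟨0, 0, 0, 1, -10⟩ : WeierstrassCurve ℚ) (⟨0, -12, 0, -16, 0⟩ : WeierstrassCurve ℚ) q ∧ q ≠ 23)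
    (hQM : haveI := isElliptic_52a1;
      AllPrimesSplitInSqrt (2 * (⟨0, 0, 0, 1, -10⟩ : WeierstrassCurve ℚ).conductorNorm ℤ) (∏ q ∈ Q, qStar q))
    (W : WeierstrassCurve ℚ) [W.IsElliptic] [W.IsGloballyMinimal]
    (hW : ∃ C : VariableChange ℚ, C • (⟨0, 0, 0, 1, -10⟩ : WeierstrassCurve ℚ).quadraticTwist ((∏ q ∈ Q, qStar q : ℤ) : ℚ) = W) :
    haveI : Fact (Nat.Prime 2) := ⟨Nat.prime_two⟩
    W.analyticRank = 0 ∧ Addv W 2 ∧ 0 ≤ padicValRat 2 W.j ∧ ¬ W.HasCM ∧ Red W 2 ∧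
      BSDp W 2 ∧ MissingLowerBoundAt W 2 ∧ MissingUpperBoundAt W 2 := by
  obtain ⟨hN, Dt, hopt, hcusp⟩ := htab
  haveI := hN
  exact printFamily52a1_of_shuZhai h12 h14 h26 hCM hmod Dt hopt hcusp Q hQ hQM W hW

/-- **THE RANK-ONE COMPANIONS `52a1^{(−23M)}`, BY NAME from the Table row**: at every global minimal `W₁ ≅ 52a1^{(−23·M)}`: `r_an(W₁) = 1 ∧
Addv ∧ 0 ≤ ord₂ j ∧ ¬CM ∧ Red ∧ BSD(W₁, 2)`. BSD is not proved by any of this.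
[cite: ShuZhai2021, Thm. 1.2, Thm. 1.4 and §5.2 Table (row 52a1)] [cite: CreutzMiller2012, Thm. 1.1] [cite: Miller2011LMS, Def. 1.1] -/
theorem printFamily52a1_rankOne_of_shuZhai_of_table52 (h12 : thm12_ranks_of_twists) (h14 : thm14_twoPartBSD_of_twists)
    (htab : table52_row52a1) (h26 : cremona_abs_maninConstant_eq_one_of_level_le) (hCM : bsdTriple_of_analyticRank_le_one_of_conductor_lt)
    (hmod : hasEntireLFunction_rat)
    (Q : Finset ℕ) (hQ : haveI := isElliptic_52a1;
      ∀ q ∈ Q, IsAdmissible (⟨0, 0, 0, 1, -10⟩ : WeierstrassCurve ℚ) (⟨0, -12, 0, -16, 0⟩ : WeierstrassCurve ℚ) q ∧ q ≠ 23)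
    (hQM : haveI := isElliptic_52a1;
      AllPrimesSplitInSqrt (2 * (⟨0, 0, 0, 1, -10⟩ : WeierstrassCurve ℚ).conductorNorm ℤ) (∏ q ∈ Q, qStar q))
    (W₁ : WeierstrassCurve ℚ) [W₁.IsElliptic] [W₁.IsGloballyMinimal]
    (hW₁ : ∃ C : VariableChange ℚ,
      C • (⟨0, 0, 0, 1, -10⟩ : WeierstrassCurve ℚ).quadraticTwist ((-(23 : ℕ) * ∏ q ∈ Q, qStar q : ℤ) : ℚ) = W₁) :
    haveI : Fact (Nat.Prime 2) := ⟨Nat.prime_two⟩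
    W₁.analyticRank = 1 ∧ Addv W₁ 2 ∧ 0 ≤ padicValRat 2 W₁.j ∧ ¬ W₁.HasCM ∧ Red W₁ 2 ∧ BSDp W₁ 2 := by
  obtain ⟨hN, Dt, hopt, hcusp⟩ := htab
  haveI := hN
  exact printFamily52a1_rankOne_of_shuZhai h12 h14 h26 hCM hmod Dt hopt hcusp Q hQ hQM W₁ hW₁

/-! ## The road at `84a1` by name from the Table row -/

/-- **THE SHU–ZHAI ROAD AT `84a1`, BY NAME from the §5.2 Table row** (`ShuZhai2021.table52_row84a1`: the optimal datum of `[0,1,0,7,0]` and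
`f([0]) ∉ 2E(ℚ)`): for every finite set `Q` of admissible primes (`≠ 47`) with «every `ℓ ∣ 2N` splits in `ℚ(√M)`», `M = ∏ q*`, and every global
minimal `W ≅ 84a1^{(M)}`: `r_an(W) = 0 ∧ Addv W 2 ∧ 0 ≤ ord₂ j(W) ∧ ¬CM ∧ Red W 2 ∧ BSD(W, 2) ∧ MissingLowerBoundAt W 2 ∧ MissingUpperBoundAt W 2`.
No displayed base datum. BSD is not proved by any of this.
[cite: ShuZhai2021, Thm. 1.2, Thm. 1.4 and §5.2 Table (row 84a1)] [cite: CreutzMiller2012, Thm. 1.1] [cite: AgasheRibetStein2006, Thm. 2.6] [cite: Miller2011LMS, Def. 1.1] -/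
theorem printFamily84a1_of_shuZhai_of_table52 (h12 : thm12_ranks_of_twists) (h14 : thm14_twoPartBSD_of_twists)
    (htab : table52_row84a1) (h26 : cremona_abs_maninConstant_eq_one_of_level_le) (hCM : bsdTriple_of_analyticRank_le_one_of_conductor_lt)
    (hmod : hasEntireLFunction_rat)
    (Q : Finset ℕ) (hQ : haveI := isElliptic_84a1;
      ∀ q ∈ Q, IsAdmissible (⟨0, 1, 0, 7, 0⟩ : WeierstrassCurve ℚ) (⟨0, -2, 0, -27, 0⟩ : WeierstrassCurve ℚ) q ∧ q ≠ 47)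
    (hQM : haveI := isElliptic_84a1;
      AllPrimesSplitInSqrt (2 * (⟨0, 1, 0, 7, 0⟩ : WeierstrassCurve ℚ).conductorNorm ℤ) (∏ q ∈ Q, qStar q))
    (W : WeierstrassCurve ℚ) [W.IsElliptic] [W.IsGloballyMinimal]
    (hW : ∃ C : VariableChange ℚ, C • (⟨0, 1, 0, 7, 0⟩ : WeierstrassCurve ℚ).quadraticTwist ((∏ q ∈ Q, qStar q : ℤ) : ℚ) = W) :
    haveI : Fact (Nat.Prime 2) := ⟨Nat.prime_two⟩
    W.analyticRank = 0 ∧ Addv W 2 ∧ 0 ≤ padicValRat 2 W.j ∧ ¬ W.HasCM ∧ Red W 2 ∧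
      BSDp W 2 ∧ MissingLowerBoundAt W 2 ∧ MissingUpperBoundAt W 2 := by
  obtain ⟨hN, Dt, hopt, hcusp⟩ := htab
  haveI := hN
  exact printFamily84a1_of_shuZhai h12 h14 h26 hCM hmod Dt hopt hcusp Q hQ hQM W hW

/-- **THE RANK-ONE COMPANIONS `84a1^{(−47M)}`, BY NAME from the Table row**: at every global minimal `W₁ ≅ 84a1^{(−47·M)}`: `r_an(W₁) = 1 ∧
Addv ∧ 0 ≤ ord₂ j ∧ ¬CM ∧ Red ∧ BSD(W₁, 2)`. BSD is not proved by any of this.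
[cite: ShuZhai2021, Thm. 1.2, Thm. 1.4 and §5.2 Table (row 84a1)] [cite: CreutzMiller2012, Thm. 1.1] [cite: Miller2011LMS, Def. 1.1] -/
theorem printFamily84a1_rankOne_of_shuZhai_of_table52 (h12 : thm12_ranks_of_twists) (h14 : thm14_twoPartBSD_of_twists)
    (htab : table52_row84a1) (h26 : cremona_abs_maninConstant_eq_one_of_level_le) (hCM : bsdTriple_of_analyticRank_le_one_of_conductor_lt)
    (hmod : hasEntireLFunction_rat)
    (Q : Finset ℕ) (hQ : haveI := isElliptic_84a1;
      ∀ q ∈ Q, IsAdmissible (⟨0, 1, 0, 7, 0⟩ : WeierstrassCurve ℚ) (⟨0, -2, 0, -27, 0⟩ : WeierstrassCurve ℚ) q ∧ q ≠ 47)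
    (hQM : haveI := isElliptic_84a1;
      AllPrimesSplitInSqrt (2 * (⟨0, 1, 0, 7, 0⟩ : WeierstrassCurve ℚ).conductorNorm ℤ) (∏ q ∈ Q, qStar q))
    (W₁ : WeierstrassCurve ℚ) [W₁.IsElliptic] [W₁.IsGloballyMinimal]
    (hW₁ : ∃ C : VariableChange ℚ,
      C • (⟨0, 1, 0, 7, 0⟩ : WeierstrassCurve ℚ).quadraticTwist ((-(47 : ℕ) * ∏ q ∈ Q, qStar q : ℤ) : ℚ) = W₁) :
    haveI : Fact (Nat.Prime 2) := ⟨Nat.prime_two⟩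
    W₁.analyticRank = 1 ∧ Addv W₁ 2 ∧ 0 ≤ padicValRat 2 W₁.j ∧ ¬ W₁.HasCM ∧ Red W₁ 2 ∧ BSDp W₁ 2 := by
  obtain ⟨hN, Dt, hopt, hcusp⟩ := htab
  haveI := hN
  exact printFamily84a1_rankOne_of_shuZhai h12 h14 h26 hCM hmod Dt hopt hcusp Q hQ hQM W₁ hW₁

end Summit.BirchSwinnertonDyer.BirchSwinnertonDyer.Theorems.AddPotGoodPrint

end
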